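import Literature.AlgebraicGeometry.Smoothening.DilatationDefectDrop
import Mathlib.RingTheory.Ideal.Quotient.Operations
import Mathlib.RingTheory.MvPolynomial.Basic
import HarnessLib

/-!
# The dilatation as a closed subscheme of affine space (the "affine forest", BLR 3.4)

Topic: `Literature/AlgebraicGeometry/Smoothening` (Bosch–Lütkebohmert–Raynaud, *Néron Models*,
§3.2 and §3.4: in the smoothening process each dilatation `X' = Spec A[𝔟/ϖ]` of a chart
`X = Spec B/I`, `B = R[T₁, …, T_N]`, with centre `𝔟 = (ϖ, g₁, …, g_r)`, is again presented as a
quotient of a polynomial ring, so that the process can be iterated with `DefectDropPointwise`):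

  `dilMap : R[T₁, …, T_N, Z₁, …, Z_r] → A[𝔟/ϖ]`,  `Tᵢ ↦ tᵢ`, `Zⱼ ↦ zⱼ = ḡⱼ/ϖ`

(`dilMap_rename`, `dilMap_X_natAdd`) is surjective (`dilMap_surjective`, from
`adjoin_dilatationZ_eq_top`); `dilIdeal = ker` and `R[T, Z]/dilIdeal ≅ A[𝔟/ϖ]` (`dilEquiv`), an
isomorphism of `A`-algebras (`dilEquiv'`), so Néron's measure is the same on both sides
(`neronDefect_dil_eq`, through the general `neronDefect_eq_of_algEquiv`). [folklore]; no named
facts (D-0026).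

## References

* S. Bosch, W. Lütkebohmert, M. Raynaud, *Néron Models*, Springer 1990, §3.2, §3.4.
  [BLRNeronModels1990] (Not held; numbers only.)
-/

noncomputable section

open MvPolynomial
open Literature.AlgebraicGeometry.Dilatations Literature.AlgebraicGeometry.Resolution

namespace Literature.AlgebraicGeometry.Smoothening

universe u

/-! ### `δ` is invariant under isomorphisms of `R`-algebras -/

section AlgEquiv

variable (R : Type u) [CommRing R] {A₁ : Type u} [CommRing A₁] [Algebra R A₁] {A₂ : Type u}
  [CommRing A₂] [Algebra R A₂] (e : A₁ ≃ₐ[R] A₂) (R' : Type u) [CommRing R'] [Algebra A₁ R']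
  [Algebra A₂ R']

/-- **Néron's measure is invariant under `R`-algebra isomorphisms compatible with the points.**
(An isomorphism is a localisation at the units; `neronDefect_eq_of_isLocalization`.)
[folklore] -/
theorem neronDefect_eq_of_algEquiv (he : ∀ x, algebraMap A₂ R' (e x) = algebraMap A₁ R' x) :
    neronDefect R A₁ R' = neronDefect R A₂ R' := by
  letI : Algebra A₁ A₂ := (e : A₁ →+* A₂).toAlgebra
  haveI : IsScalarTower R A₁ A₂ := IsScalarTower.of_algebraMap_eq fun r => (e.commutes r).symm
  haveI : IsScalarTower A₁ A₂ R' := IsScalarTower.of_algebraMap_eq fun x => (he x).symm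
  let e' : A₁ ≃ₐ[A₁] A₂ := AlgEquiv.ofRingEquiv (f := e.toRingEquiv) fun _ => rfl
  haveI : IsLocalization (IsUnit.submonoid A₁) A₂ :=
    IsLocalization.isLocalization_of_algEquiv (IsUnit.submonoid A₁) e'
  exact neronDefect_eq_of_isLocalization R A₁ A₂ (IsUnit.submonoid A₁) R'

end AlgEquiv

/-! ### The presentation of the dilatation -/

section Dilatation

variable {R : Type u} [CommRing R] (ϖ : R) {N r : ℕ} (I : Ideal (MvPolynomial (Fin N) R))
  (g : Fin r → MvPolynomial (Fin N) R)

/-- The values of the variables: `Tᵢ ↦ tᵢ`, `Zⱼ ↦ zⱼ = ḡⱼ/ϖ`. [folklore] -/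
def dilVal : Fin (N + r) → dilatation ϖ (centreIdeal ϖ I g) :=
  Fin.append (fun i => algebraMap (MvPolynomial (Fin N) R ⧸ I) _ (Ideal.Quotient.mk I (X i)))
    (dilatationZ ϖ I g)

/-- **The presentation map** `R[T₁, …, T_N, Z₁, …, Z_r] → A[𝔟/ϖ]`. [folklore] -/
def dilMap : MvPolynomial (Fin (N + r)) R →ₐ[R] dilatation ϖ (centreIdeal ϖ I g) :=
  aeval (dilVal ϖ I g)

/-- `Tᵢ ↦ tᵢ`. [folklore] -/
@[simp]
theorem dilMap_X_castAdd (i : Fin N) :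
    dilMap ϖ I g (X (Fin.castAdd r i)) =
      algebraMap (MvPolynomial (Fin N) R ⧸ I) _ (Ideal.Quotient.mk I (X i)) := by
  rw [dilMap, aeval_X, dilVal, Fin.append_left]

/-- `Zⱼ ↦ zⱼ`. [folklore] -/
@[simp]
theorem dilMap_X_natAdd (j : Fin r) : dilMap ϖ I g (X (Fin.natAdd N j)) = dilatationZ ϖ I g j := by
  rw [dilMap, aeval_X, dilVal, Fin.append_right]

/-- On polynomials in `T` alone the presentation map is `B → B/I → A[𝔟/ϖ]`. [folklore] -/
theorem dilMap_rename (p : MvPolynomial (Fin N) R) :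
    dilMap ϖ I g (rename (Fin.castAdd r) p) =
      algebraMap (MvPolynomial (Fin N) R ⧸ I) _ (Ideal.Quotient.mk I p) := by
  let ψ : MvPolynomial (Fin N) R →ₐ[R] dilatation ϖ (centreIdeal ϖ I g) :=
    (IsScalarTower.toAlgHom R (MvPolynomial (Fin N) R ⧸ I) _).comp (Ideal.Quotient.mkₐ R I)
  have hψ : ψ = aeval (dilVal ϖ I g ∘ Fin.castAdd r) := by
    rw [aeval_unique ψ]
    congr 1
    funext i
    simp [ψ, dilVal]
  change _ = ψ p
  rw [dilMap, aeval_rename, hψ]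

/-- **The presentation map is surjective** (`A[𝔟/ϖ]` is generated over `A` by the `zⱼ`,
`adjoin_dilatationZ_eq_top`). [folklore] -/
theorem dilMap_surjective : Function.Surjective (dilMap ϖ I g) := by
  intro d
  have hd : d ∈ Algebra.adjoin (MvPolynomial (Fin N) R ⧸ I) (Set.range (dilatationZ ϖ I g)) := by
    rw [adjoin_dilatationZ_eq_top]; trivial
  refine Algebra.adjoin_induction (p := fun x _ => ∃ y, dilMap ϖ I g y = x) ?_ ?_ ?_ ?_ hd
  · rintro _ ⟨j, rfl⟩
    exact ⟨X (Fin.natAdd N j), dilMap_X_natAdd ϖ I g j⟩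
  · intro a
    obtain ⟨p, rfl⟩ := Ideal.Quotient.mk_surjective a
    exact ⟨rename (Fin.castAdd r) p, dilMap_rename ϖ I g p⟩
  · rintro x y - - ⟨x', rfl⟩ ⟨y', rfl⟩
    exact ⟨x' + y', map_add _ _ _⟩
  · rintro x y - - ⟨x', rfl⟩ ⟨y', rfl⟩
    exact ⟨x' * y', map_mul _ _ _⟩

/-- **The ideal of the dilatation in `R[T, Z]`**: the kernel of the presentation map. [folklore] -/
def dilIdeal : Ideal (MvPolynomial (Fin (N + r)) R) := RingHom.ker (dilMap ϖ I g)

/-- `R[T, Z]/dilIdeal ≅ A[𝔟/ϖ]`. [folklore] -/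
def dilEquiv : (MvPolynomial (Fin (N + r)) R ⧸ dilIdeal ϖ I g) ≃ₐ[R]
    dilatation ϖ (centreIdeal ϖ I g) :=
  Ideal.quotientKerAlgEquivOfSurjective (dilMap_surjective ϖ I g)

/-- The isomorphism on classes. [folklore] -/
@[simp]
theorem dilEquiv_mk (x : MvPolynomial (Fin (N + r)) R) :
    dilEquiv ϖ I g (Ideal.Quotient.mk _ x) = dilMap ϖ I g x := rfl

/-- `R[T, Z]/dilIdeal` as an `A`-algebra, `A = B/I`: `A → A[𝔟/ϖ] ≅ R[T, Z]/dilIdeal`.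
[folklore] -/
instance algebraDil : Algebra (MvPolynomial (Fin N) R ⧸ I)
    (MvPolynomial (Fin (N + r)) R ⧸ dilIdeal ϖ I g) :=
  (((dilEquiv ϖ I g).symm : dilatation ϖ (centreIdeal ϖ I g) →+*
      MvPolynomial (Fin (N + r)) R ⧸ dilIdeal ϖ I g).comp
    (algebraMap (MvPolynomial (Fin N) R ⧸ I) (dilatation ϖ (centreIdeal ϖ I g)))).toAlgebra

/-- The structure map, unfolded. [folklore] -/
theorem algebraMap_dil_apply (a : MvPolynomial (Fin N) R ⧸ I) :
    algebraMap (MvPolynomial (Fin N) R ⧸ I) (MvPolynomial (Fin (N + r)) R ⧸ dilIdeal ϖ I g) a =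
      (dilEquiv ϖ I g).symm (algebraMap _ (dilatation ϖ (centreIdeal ϖ I g)) a) := rfl

/-- On classes of polynomials: `t̄ᵢ ↦ Tᵢ mod dilIdeal`. [folklore] -/
theorem algebraMap_dil_mk (p : MvPolynomial (Fin N) R) :
    algebraMap (MvPolynomial (Fin N) R ⧸ I) (MvPolynomial (Fin (N + r)) R ⧸ dilIdeal ϖ I g)
        (Ideal.Quotient.mk I p) = Ideal.Quotient.mk _ (rename (Fin.castAdd r) p) := by
  rw [algebraMap_dil_apply, ← dilMap_rename, ← dilEquiv_mk, AlgEquiv.symm_apply_apply]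

/-- The presentation is an `R`-`A`-tower. [folklore] -/
instance isScalarTower_dil : IsScalarTower R (MvPolynomial (Fin N) R ⧸ I)
    (MvPolynomial (Fin (N + r)) R ⧸ dilIdeal ϖ I g) :=
  IsScalarTower.of_algebraMap_eq (R := R) (S := MvPolynomial (Fin N) R ⧸ I)
    (A := MvPolynomial (Fin (N + r)) R ⧸ dilIdeal ϖ I g) fun c => by
    rw [algebraMap_dil_apply, ← IsScalarTower.algebraMap_apply R (MvPolynomial (Fin N) R ⧸ I)
      (dilatation ϖ (centreIdeal ϖ I g)) c]
    exact ((dilEquiv ϖ I g).symm.commutes c).symm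

/-- The presentation isomorphism is `A`-linear. [folklore] -/
def dilEquiv' : dilatation ϖ (centreIdeal ϖ I g) ≃ₐ[MvPolynomial (Fin N) R ⧸ I]
    MvPolynomial (Fin (N + r)) R ⧸ dilIdeal ϖ I g :=
  AlgEquiv.ofRingEquiv (f := (dilEquiv ϖ I g).symm.toRingEquiv) fun _ => rfl

/-- **Néron's measure of a point of the dilatation is the same in the presentation**, for
compatible points with values in `R'`. [folklore] -/
theorem neronDefect_dil_eq (R' : Type u) [CommRing R']
    [Algebra (dilatation ϖ (centreIdeal ϖ I g)) R']
    [Algebra (MvPolynomial (Fin (N + r)) R ⧸ dilIdeal ϖ I g) R']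
    (he : ∀ x, algebraMap (MvPolynomial (Fin (N + r)) R ⧸ dilIdeal ϖ I g) R' ((dilEquiv ϖ I g).symm x) =
      algebraMap (dilatation ϖ (centreIdeal ϖ I g)) R' x) :
    neronDefect R (MvPolynomial (Fin (N + r)) R ⧸ dilIdeal ϖ I g) R' =
      neronDefect R (dilatation ϖ (centreIdeal ϖ I g)) R' :=
  (neronDefect_eq_of_algEquiv R (dilEquiv ϖ I g).symm R' he).symm

end Dilatation

end Literature.AlgebraicGeometry.Smoothening

end
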